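import Literature.MathematicalPhysics.QuantumFieldTheory.Balaban1983to89.B4Prop31Energy

/-!
# B4 (4.5)–(4.6): *"separating subsets of Ω by the Neumann boundary conditions"* — the decoupling lower bound for the
quadratic form of `Δ^{(k)}(Ω,A)`, for every link field

T. Bałaban, *Regularity and decay of lattice Green's functions*, Commun. Math. Phys. **89** (1983) 571–597
[Balaban1983RegularityDecay] (= B4), §4, pp. 589–590 [PDF 19–20] (journal page = PDF page + 570; renders
`run/shared/lean/pub/pub-balaban/b2b-balaban-ref1/pages/1983-cmp89-regularity-decay/…-p019-x2.png`, `…-p020-x2.png`).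
Unit lit-balaban-r01 gen 4 (reader/typer of block B4; rows B4.Prop3.1'[II] / B4.Eq4.4 of `lit-balaban-r01/ROWS-B4.md`);
statement-level skeleton of published theorems with citation tags; proofs where landed; nothing here is a claim
about the Yang–Mills mass gap.

## The printed passage (pp. 589–590, verbatim from the ×2 renders)

p. 589: *"Now let us consider the set of all positively oriented bonds ⟨x,x′⟩ ⊂ Ω^{(k)}. This set can be represented as
a sum of 2d subsets B_i with the property that each point of Ω^{(k)} belongs to at most one bond in a given subset
B_i. … For a given B_i there may be points which do not belong to any bond of this set. Let us denote Δ(x,x′) = B^k(x)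
∪ B^k(x′). Again separating subsets of Ω by the Neumann boundary conditions we have"*
p. 590: *"(the left hand side of (1.18)) ≥ Σ_{⟨x,x′⟩∈B_i}[a_k|φ(x)|² + a_k|φ(x′)|² − a_k²⟨φ,Q_k(A)G_k(Δ(x,x′),A)Q_k^*(A)φ⟩]
+ Σ_{x∈Ω^{(k)}, x does not belong to a bond in B_i}[a_k|φ(x)|² − a_k²φ(x)·(Q_k(A)G_k(B^k(x),A)Q_k^*(A))(x,x)φ(x)]. (4.5)
Each term in the second sum of the right side (4.5) is non-negative, as it follows from the proof of (4.4), so we can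
omit these terms. Summing the inequalities (4.5) over B_i, i = 1,…,2d, we get the inequality (the left hand side of
(1.18)) ≥ (1/2d)Σ_{⟨x,x′⟩⊂Ω^{(k)}}[a_k|φ(x)|² + a_k|φ(x′)|² − a_k²⟨φ,Q_k(A)G_k(Δ(x,x′),A)Q_k^*(A)φ⟩]. (4.6)"*
(*"the left hand side of (1.18)"* = `⟨φ, Δ^{(k)}(Ω,A)φ⟩` of (1.22), by the global +4 cross-reference erratum of the
paper, CENSUS-r01.)

## Typing (generic; the dictionary of `B4GaugeCovariance` / `B4Prop31Energy`, nothing re-declared)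

`Δ^{(k)}(Ω,A)` for ARBITRARY bond weights `c`, link variables `W`, block weights `q`, transporters `T`, `m² `, `a = a_k`,
`s` is `B4Prop31Energy.keff c m2 a s q W T` (= `a·1 − a²s·Q·G·Qᵀ`, (1.14)), its variational representation (4.1)–(4.3)
is `B4Prop31Energy.cenergy`/`gStar`/`cenergy_gStar`/`cenergy_ge_keff`.  A *"separation of subsets of Ω by the
Neumann boundary conditions"* is a cell structure: maps `cellX : X → C` (fine sites) and `cellY : Y → C` (unit sites)
to a finite set of cells, compatible with the blocks (`q(y,x) ≠ 0 ⇒ cellX x = cellY y`); the operator of the cell `i`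
is the SAME construction on the restricted data (`cR`, `WR`, `qR`, `TR` on the subtypes `{x // cellX x = i}`,
`{y // cellY y = i}`) — for the cells `Δ(x,x′)` of `B_i` this is `Δ^{(k)}(Δ(x,x′),A)`, for the singletons `B^k(x)` it is
`a_k − a_k²(Q_kG_k(B^k(x),A)Q_k^*)(x,x)`; Neumann conditions = the bonds between different cells are dropped (`ccut`).

## What is proved (kernel-checked, 0 sorry; definitions with bodies + theorems; no named fact)

* §1 restriction of the data to a cell and the cut weights; the fibrewise sum identities.
* §2 `cenergy_cut_le` (dropping the inter-cell bonds lowers the energy (4.2), `c ≥ 0`), `cenergy_cut_eq_sum` (the cut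
  energy IS the sum of the cell energies), `covOp_form_ge_of_cells` (positivity passes from the cells to `Ω`).
* §3 **(4.5)** `ineq45`: `⟨ψ, Δ^{(k)}(Ω,A)ψ⟩ ≥ Σ_{cells i} ⟨ψ|_i, Δ^{(k)}(cell i, A)ψ|_i⟩` for EVERY cell structure,
  every link field and every `ψ` (hypotheses: `c ≥ 0`, `0 < s`, `0 ≤ a`, and the positivity (1.8) `H_i ≥ γ > 0` of each
  cell operator); *"Each term in the second sum … is non-negative"*: `keff_form_nonneg` (every cell term is `≥ 0`,
  `m² ≥ 0`); **(4.6)** `ineq46`: the average of the inequalities (4.5) over any finite family of cell structures.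
The lattice combinatorics of p. 589 (the `2d` matchings `B_{2μ−1}`, `B_{2μ}` of `Ω^{(k)} ⊂ ℤ^d` by the parity of `x_μ`)
is not needed for these statements and is not formalised here (v1.1 note: it has since been formalised by r04 g11 in
`…B4Ineq46Lattice` — `matching`, `eq_of_mem_matching_of_mem_ends`, `ineq46_printed`, `ineq46_printed_region` — on top of this
module՚s `ineq45`/`keffCell`).
-/

namespace Literature.MathematicalPhysics.QuantumFieldTheory.Balaban1983to89.B4Ineq45Decoupling

open Matrix Finset
open Literature.MathematicalPhysics.QuantumFieldTheory.Balaban1983to89.B4GaugeCovariance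
open Literature.MathematicalPhysics.QuantumFieldTheory.Balaban1983to89.B4Lower18Regular
  (dotProduct_self_nonneg' dotProduct_eq_sum_fld covOp_form isUnit_det_of_form_ge)
open Literature.MathematicalPhysics.QuantumFieldTheory.Balaban1983to89.B4Prop31Energy

noncomputable section

variable {X Y ι C : Type*}

/-! ## §1. Cells, restricted data, cut weights -/

/-- the fine sites of the cell `i`. [cite: Balaban1983RegularityDecay, p.589 («Δ(x,x′) = B^k(x) ∪ B^k(x′)»)] -/
abbrev XC (cellX : X → C) (i : C) := {x : X // cellX x = i}

/-- the unit-lattice sites of the cell `i`. [cite: Balaban1983RegularityDecay, p.589] -/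
abbrev YC (cellY : Y → C) (i : C) := {y : Y // cellY y = i}

/-- bond weights restricted to the cell. [cite: Balaban1983RegularityDecay, (4.5) p.590] -/
def cR (cellX : X → C) (c : X → X → ℝ) (i : C) : XC cellX i → XC cellX i → ℝ := fun x x' => c x.1 x'.1

/-- link variables restricted to the cell. [cite: Balaban1983RegularityDecay, (4.5) p.590] -/
def WR (cellX : X → C) (W : X → X → Matrix ι ι ℝ) (i : C) : XC cellX i → XC cellX i → Matrix ι ι ℝ :=
  fun x x' => W x.1 x'.1

/-- block weights restricted to the cell. [cite: Balaban1983RegularityDecay, (4.5) p.590] -/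
def qR (cellX : X → C) (cellY : Y → C) (q : Y → X → ℝ) (i : C) : YC cellY i → XC cellX i → ℝ :=
  fun y x => q y.1 x.1

/-- transporters restricted to the cell. [cite: Balaban1983RegularityDecay, (4.5) p.590] -/
def TR (cellX : X → C) (cellY : Y → C) (T : Y → X → Matrix ι ι ℝ) (i : C) :
    YC cellY i → XC cellX i → Matrix ι ι ℝ := fun y x => T y.1 x.1

/-- a fine field restricted to the cell. [cite: Balaban1983RegularityDecay, (4.5) p.590] -/
def ΦR (cellX : X → C) (i : C) (Φ : X × ι → ℝ) : XC cellX i × ι → ℝ := fun z => Φ (z.1.1, z.2)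

/-- a unit-lattice field restricted to the cell (`φ|_{Δ(x,x′)}`). [cite: Balaban1983RegularityDecay, (4.5) p.590] -/
def ψR (cellY : Y → C) (i : C) (ψ : Y × ι → ℝ) : YC cellY i × ι → ℝ := fun z => ψ (z.1.1, z.2)

/-- **the Neumann cut**: the bonds between different cells are dropped.
[cite: Balaban1983RegularityDecay, p.589 («separating subsets of Ω by the Neumann boundary conditions»)] -/
def ccut [DecidableEq C] (cellX : X → C) (c : X → X → ℝ) : X → X → ℝ :=
  fun x x' => if cellX x = cellX x' then c x x' else 0

/-- **the operator `Δ^{(k)}(cell i, A)` of a cell**: the same construction (1.14) on the restricted data (for the cell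
`Δ(x,x′)`: `Δ^{(k)}(Δ(x,x′),A)`; for a singleton cell `B^k(x)`: `a_k − a_k²(Q_k(A)G_k(B^k(x),A)Q_k^*(A))(x,x)`).
[cite: Balaban1983RegularityDecay, (4.5) p.590] -/
def keffCell [Fintype X] [Fintype Y] [Fintype ι] [DecidableEq X] [DecidableEq Y] [DecidableEq ι] [DecidableEq C]
    (cellX : X → C) (cellY : Y → C) (c : X → X → ℝ) (m2 a s : ℝ) (q : Y → X → ℝ) (W : X → X → Matrix ι ι ℝ)
    (T : Y → X → Matrix ι ι ℝ) (i : C) : Matrix (YC cellY i × ι) (YC cellY i × ι) ℝ :=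
  keff (cR cellX c i) m2 a s (qR cellX cellY q i) (WR cellX W i) (TR cellX cellY T i)

/-- restriction commutes with `fld`. [cite: Balaban1983RegularityDecay, (4.5) p.590] -/
theorem fld_ΦR (cellX : X → C) (i : C) (Φ : X × ι → ℝ) (x : XC cellX i) : fld (ΦR cellX i Φ) x = fld Φ x.1 := rfl

/-- restriction commutes with `fld`. [cite: Balaban1983RegularityDecay, (4.5) p.590] -/
theorem fld_ψR (cellY : Y → C) (i : C) (ψ : Y × ι → ℝ) (y : YC cellY i) : fld (ψR cellY i ψ) y = fld ψ y.1 := rfl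

/-- a sum over the sites is the sum over the cells of the sums over their sites. [folklore] -/
private theorem sum_cells {β : Type*} [AddCommMonoid β] [Fintype X] [Fintype C] [DecidableEq C] (cellX : X → C)
    (F : X → β) : ∑ x, F x = ∑ i, ∑ x : XC cellX i, F x.1 :=
  (Fintype.sum_fiberwise cellX F).symm

/-- a sum of a function supported in one cell. [folklore] -/
private theorem sum_cell_support {β : Type*} [AddCommMonoid β] [Fintype X] [Fintype C] [DecidableEq C]
    (cellX : X → C) (i : C) (F : X → β) (hF : ∀ x, cellX x ≠ i → F x = 0) :
    ∑ x, F x = ∑ x : XC cellX i, F x.1 := by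
  rw [sum_cells cellX F, Finset.sum_eq_single i]
  · intro j _ hj
    exact Finset.sum_eq_zero fun x _ => hF x.1 (by rw [x.2]; exact hj)
  · intro h; exact absurd (Finset.mem_univ i) h

/-! ## §2. The energy (4.2) under the Neumann cut -/

/-- dropping the inter-cell bonds lowers the kinetic form (`c ≥ 0`).
[cite: Balaban1983RegularityDecay, p.589 (Neumann conditions)] -/
theorem covLap_form_cut_le [Fintype X] [Fintype ι] [DecidableEq X] [DecidableEq ι] [DecidableEq C] (cellX : X → C)
    {c : X → X → ℝ} (hc : ∀ x x', 0 ≤ c x x') (W : X → X → Matrix ι ι ℝ) (Φ : X × ι → ℝ) :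
    Φ ⬝ᵥ (covLap (ccut cellX c) W *ᵥ Φ) ≤ Φ ⬝ᵥ (covLap c W *ᵥ Φ) := by
  rw [covLap_form, covLap_form]
  refine Finset.sum_le_sum fun x _ => Finset.sum_le_sum fun y _ => ?_
  refine mul_le_mul_of_nonneg_right ?_ (dotProduct_self_nonneg' _)
  unfold ccut
  split_ifs
  · exact le_rfl
  · exact hc x y

/-- the kinetic form is nonnegative for `c ≥ 0`. [cite: Balaban1983RegularityDecay, (1.3) p.572] -/
theorem covLap_form_nonneg [Fintype X] [Fintype ι] [DecidableEq X] [DecidableEq ι] {c : X → X → ℝ}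
    (hc : ∀ x x', 0 ≤ c x x') (W : X → X → Matrix ι ι ℝ) (Φ : X × ι → ℝ) : 0 ≤ Φ ⬝ᵥ (covLap c W *ᵥ Φ) := by
  rw [covLap_form]
  exact Finset.sum_nonneg fun x _ => Finset.sum_nonneg fun y _ =>
    mul_nonneg (hc x y) (dotProduct_self_nonneg' _)

/-- the kinetic-plus-mass form unfolded. [cite: Balaban1983RegularityDecay, (4.2) p.589] -/
theorem kinMass_form [Fintype X] [Fintype ι] [DecidableEq X] [DecidableEq ι] (c : X → X → ℝ)
    (W : X → X → Matrix ι ι ℝ) (m2 : ℝ) (Φ : X × ι → ℝ) :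
    Φ ⬝ᵥ ((covLap c W + m2 • (1 : Matrix (X × ι) (X × ι) ℝ)) *ᵥ Φ) = Φ ⬝ᵥ (covLap c W *ᵥ Φ) + m2 * (Φ ⬝ᵥ Φ) := by
  rw [Matrix.add_mulVec, dotProduct_add, Matrix.smul_mulVec, Matrix.one_mulVec, dotProduct_smul, smul_eq_mul]

/-- **the Neumann cut lowers the energy (4.2)**: `F_cut(Φ,ψ) ≤ F_Ω(Φ,ψ)` for `c ≥ 0`, `s ≥ 0`.
[cite: Balaban1983RegularityDecay, pp.589–590, (4.2), (4.5)] -/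
theorem cenergy_cut_le [Fintype X] [Fintype Y] [Fintype ι] [DecidableEq X] [DecidableEq ι] [DecidableEq C]
    (cellX : X → C) {c : X → X → ℝ} (hc : ∀ x x', 0 ≤ c x x') (m2 a : ℝ) {s : ℝ} (hs : 0 ≤ s) (q : Y → X → ℝ)
    (W : X → X → Matrix ι ι ℝ) (T : Y → X → Matrix ι ι ℝ) (Φ : X × ι → ℝ) (ψ : Y × ι → ℝ) :
    cenergy (ccut cellX c) m2 a s q W T Φ ψ ≤ cenergy c m2 a s q W T Φ ψ := by
  unfold cenergy
  have h := covLap_form_cut_le cellX hc W Φ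
  rw [kinMass_form, kinMass_form]
  nlinarith [mul_le_mul_of_nonneg_left h hs]

/-- the cut kinetic form is the sum of the cell kinetic forms. [cite: Balaban1983RegularityDecay, (4.5) p.590] -/
theorem covLap_form_cut_eq_sum [Fintype X] [Fintype ι] [Fintype C] [DecidableEq X] [DecidableEq ι] [DecidableEq C]
    (cellX : X → C) (c : X → X → ℝ) (W : X → X → Matrix ι ι ℝ) (Φ : X × ι → ℝ) :
    Φ ⬝ᵥ (covLap (ccut cellX c) W *ᵥ Φ)
      = ∑ i, ΦR cellX i Φ ⬝ᵥ (covLap (cR cellX c i) (WR cellX W i) *ᵥ ΦR cellX i Φ) := by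
  rw [covLap_form]
  simp_rw [covLap_form, fld_ΦR]
  rw [sum_cells cellX]
  refine Finset.sum_congr rfl fun i _ => Finset.sum_congr rfl fun x _ => ?_
  rw [sum_cell_support cellX i]
  · refine Finset.sum_congr rfl fun y _ => ?_
    rw [ccut, if_pos (by rw [x.2, y.2])]
    rfl
  · intro y hy
    rw [ccut, if_neg (by rw [x.2]; exact fun h => hy h.symm), zero_mul]

/-- the mass term splits over the cells. [cite: Balaban1983RegularityDecay, (4.5) p.590] -/
theorem dotProduct_self_eq_sum [Fintype X] [Fintype ι] [Fintype C] [DecidableEq C] (cellX : X → C)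
    (Φ : X × ι → ℝ) : Φ ⬝ᵥ Φ = ∑ i, ΦR cellX i Φ ⬝ᵥ ΦR cellX i Φ := by
  rw [dotProduct_eq_sum_fld, sum_cells cellX]
  refine Finset.sum_congr rfl fun i _ => ?_
  rw [dotProduct_eq_sum_fld]
  rfl

/-- the block average at a site of the cell only sees the cell (block compatibility `q(y,x) ≠ 0 ⇒ x ∈ cell(y)`).
[cite: Balaban1983RegularityDecay, (1.4) p.572, (4.5) p.590] -/
theorem fld_avgOp_cell [Fintype X] [Fintype ι] [Fintype C] [DecidableEq C] (cellX : X → C) (cellY : Y → C)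
    {q : Y → X → ℝ} (hq : ∀ y x, q y x ≠ 0 → cellX x = cellY y) (T : Y → X → Matrix ι ι ℝ) (Φ : X × ι → ℝ) (i : C)
    (y : YC cellY i) :
    fld (avgOp q T *ᵥ Φ) y.1 = fld (avgOp (qR cellX cellY q i) (TR cellX cellY T i) *ᵥ ΦR cellX i Φ) y := by
  rw [fld_avgOp_mulVec, fld_avgOp_mulVec]
  have h : ∀ x, cellX x ≠ i → (q y.1 x • (T y.1 x *ᵥ fld Φ x)) = 0 := by
    intro x hx
    have : q y.1 x = 0 := by
      by_contra hne
      exact hx ((hq y.1 x hne).trans y.2)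
    rw [this, zero_smul]
  rw [sum_cell_support cellX i (fun x => q y.1 x • (T y.1 x *ᵥ fld Φ x)) h]
  rfl

/-- the averaging penalty `|ψ − sQΦ|²` splits over the cells. [cite: Balaban1983RegularityDecay, (4.2) p.589, (4.5) p.590] -/
theorem resid_eq_sum [Fintype X] [Fintype Y] [Fintype ι] [Fintype C] [DecidableEq C] (cellX : X → C)
    (cellY : Y → C) {q : Y → X → ℝ} (hq : ∀ y x, q y x ≠ 0 → cellX x = cellY y) (T : Y → X → Matrix ι ι ℝ)
    (s : ℝ) (Φ : X × ι → ℝ) (ψ : Y × ι → ℝ) :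
    (ψ - s • (avgOp q T *ᵥ Φ)) ⬝ᵥ (ψ - s • (avgOp q T *ᵥ Φ))
      = ∑ i, (ψR cellY i ψ - s • (avgOp (qR cellX cellY q i) (TR cellX cellY T i) *ᵥ ΦR cellX i Φ)) ⬝ᵥ
          (ψR cellY i ψ - s • (avgOp (qR cellX cellY q i) (TR cellX cellY T i) *ᵥ ΦR cellX i Φ)) := by
  rw [dotProduct_eq_sum_fld, sum_cells cellY]
  refine Finset.sum_congr rfl fun i _ => ?_
  rw [dotProduct_eq_sum_fld]
  refine Finset.sum_congr rfl fun y _ => ?_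
  have hf : fld (ψ - s • (avgOp q T *ᵥ Φ)) y.1
      = fld (ψR cellY i ψ - s • (avgOp (qR cellX cellY q i) (TR cellX cellY T i) *ᵥ ΦR cellX i Φ)) y := by
    funext j
    have h2 := congrFun (fld_avgOp_cell cellX cellY hq T Φ i y) j
    simp only [fld_apply] at h2
    simp only [fld_apply, Pi.sub_apply, Pi.smul_apply, h2]
    rfl
  rw [hf]

/-- the averaged square `|QΦ|²` splits over the cells. [cite: Balaban1983RegularityDecay, (1.5) p.572, (4.5) p.590] -/
theorem avg_sq_eq_sum [Fintype X] [Fintype Y] [Fintype ι] [Fintype C] [DecidableEq C] (cellX : X → C)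
    (cellY : Y → C) {q : Y → X → ℝ} (hq : ∀ y x, q y x ≠ 0 → cellX x = cellY y) (T : Y → X → Matrix ι ι ℝ)
    (Φ : X × ι → ℝ) :
    (avgOp q T *ᵥ Φ) ⬝ᵥ (avgOp q T *ᵥ Φ)
      = ∑ i, (avgOp (qR cellX cellY q i) (TR cellX cellY T i) *ᵥ ΦR cellX i Φ) ⬝ᵥ
          (avgOp (qR cellX cellY q i) (TR cellX cellY T i) *ᵥ ΦR cellX i Φ) := by
  rw [dotProduct_eq_sum_fld, sum_cells cellY]
  refine Finset.sum_congr rfl fun i _ => ?_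
  rw [dotProduct_eq_sum_fld]
  refine Finset.sum_congr rfl fun y _ => ?_
  rw [fld_avgOp_cell cellX cellY hq T Φ i y]

/-- **the cut energy IS the sum of the cell energies**: `F_cut(Φ,ψ) = Σ_i F_i(Φ|_i, ψ|_i)`.
[cite: Balaban1983RegularityDecay, (4.2) p.589, (4.5) p.590] -/
theorem cenergy_cut_eq_sum [Fintype X] [Fintype Y] [Fintype ι] [Fintype C] [DecidableEq X] [DecidableEq ι]
    [DecidableEq C] (cellX : X → C) (cellY : Y → C) (c : X → X → ℝ) (m2 a s : ℝ) {q : Y → X → ℝ}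
    (hq : ∀ y x, q y x ≠ 0 → cellX x = cellY y) (W : X → X → Matrix ι ι ℝ) (T : Y → X → Matrix ι ι ℝ)
    (Φ : X × ι → ℝ) (ψ : Y × ι → ℝ) :
    cenergy (ccut cellX c) m2 a s q W T Φ ψ
      = ∑ i, cenergy (cR cellX c i) m2 a s (qR cellX cellY q i) (WR cellX W i) (TR cellX cellY T i)
          (ΦR cellX i Φ) (ψR cellY i ψ) := by
  unfold cenergy
  simp_rw [kinMass_form]
  rw [covLap_form_cut_eq_sum, dotProduct_self_eq_sum cellX Φ, resid_eq_sum cellX cellY hq T s Φ ψ]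
  simp only [mul_add, Finset.mul_sum, ← Finset.sum_add_distrib]

/-- **positivity passes from the cells to `Ω`**: if every cell operator `H_i = −Δ_i + m² + a_ksP_i` satisfies
`H_i ≥ γ` then `H_Ω ≥ γ` (`c ≥ 0`). [cite: Balaban1983RegularityDecay, (1.8) p.573, (4.5) p.590] -/
theorem covOp_form_ge_of_cells [Fintype X] [Fintype Y] [Fintype ι] [Fintype C] [DecidableEq X] [DecidableEq ι]
    [DecidableEq C] (cellX : X → C) (cellY : Y → C) {c : X → X → ℝ} (hc : ∀ x x', 0 ≤ c x x') (m2 b : ℝ)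
    {q : Y → X → ℝ} (hq : ∀ y x, q y x ≠ 0 → cellX x = cellY y) (W : X → X → Matrix ι ι ℝ)
    (T : Y → X → Matrix ι ι ℝ) {γ : ℝ}
    (hH : ∀ i v, γ * (v ⬝ᵥ v) ≤ v ⬝ᵥ (covOp (cR cellX c i) m2 b (qR cellX cellY q i) (WR cellX W i)
      (TR cellX cellY T i) *ᵥ v)) (v : X × ι → ℝ) :
    γ * (v ⬝ᵥ v) ≤ v ⬝ᵥ (covOp c m2 b q W T *ᵥ v) := by
  rw [covOp_form, projOp_form]
  have h1 := covLap_form_cut_le cellX hc W v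
  rw [covLap_form_cut_eq_sum] at h1
  rw [dotProduct_self_eq_sum cellX v, avg_sq_eq_sum cellX cellY hq T v]
  have h2 : ∀ i, γ * (ΦR cellX i v ⬝ᵥ ΦR cellX i v)
      ≤ ΦR cellX i v ⬝ᵥ (covLap (cR cellX c i) (WR cellX W i) *ᵥ ΦR cellX i v)
        + m2 * (ΦR cellX i v ⬝ᵥ ΦR cellX i v)
        + b * ((avgOp (qR cellX cellY q i) (TR cellX cellY T i) *ᵥ ΦR cellX i v) ⬝ᵥ
            (avgOp (qR cellX cellY q i) (TR cellX cellY T i) *ᵥ ΦR cellX i v)) := by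
    intro i
    have h := hH i (ΦR cellX i v)
    rwa [covOp_form, projOp_form] at h
  have h3 := Finset.sum_le_sum fun i (_ : i ∈ Finset.univ) => h2 i
  rw [Finset.sum_add_distrib, Finset.sum_add_distrib, ← Finset.mul_sum, ← Finset.mul_sum, ← Finset.mul_sum] at h3
  linarith

/-! ## §3. (4.5) and (4.6) -/

/-- **(4.5)** — *"Again separating subsets of Ω by the Neumann boundary conditions we have (the left hand side of
(1.18)* [= `⟨φ,Δ^{(k)}(Ω,A)φ⟩` of (1.22)] *≥ Σ_{⟨x,x′⟩∈B_i}[a_k|φ(x)|² + a_k|φ(x′)|² − a_k²⟨φ,Q_k(A)G_k(Δ(x,x′),A)Q_k^*(A)φ⟩]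
+ Σ_{x∈Ω^{(k)}, x does not belong to a bond in B_i}[a_k|φ(x)|² − a_k²φ(x)·(Q_k(A)G_k(B^k(x),A)Q_k^*(A))(x,x)φ(x)]"* —
for EVERY cell structure compatible with the blocks, every link field and every `φ`: the form of `Δ^{(k)}(Ω,A)`
dominates the sum of the forms of the cell operators.  Mechanism (pp. 589–590, (4.1)–(4.3)): the variational value
`⟨ψ,Δ^{(k)}ψ⟩ = F_Ω(Φ⋆,ψ) ≥ F_cut(Φ⋆,ψ) = Σ_iF_i(Φ⋆|_i,ψ|_i) ≥ Σ_i⟨ψ|_i,Δ^{(k)}_iψ|_i⟩` (`B4Prop31Energy.cenergy_gStar`,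
`cenergy_cut_le`, `cenergy_cut_eq_sum`, `B4Prop31Energy.cenergy_ge_keff`).  Hypotheses: `c ≥ 0` (Neumann cut),
`0 ≤ s`, and the positivity (1.8) `H_i ≥ γ > 0` of each cell operator.
[cite: Balaban1983RegularityDecay, (4.5) p.590] -/
theorem ineq45 [Fintype X] [Fintype Y] [Fintype ι] [Fintype C] [DecidableEq X] [DecidableEq Y] [DecidableEq ι]
    [DecidableEq C] (cellX : X → C) (cellY : Y → C) {c : X → X → ℝ} (hc : ∀ x x', 0 ≤ c x x') (m2 a : ℝ)
    {s : ℝ} (hs : 0 ≤ s) {q : Y → X → ℝ} (hq : ∀ y x, q y x ≠ 0 → cellX x = cellY y)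
    (W : X → X → Matrix ι ι ℝ) (T : Y → X → Matrix ι ι ℝ) {γ : ℝ} (hγ : 0 < γ)
    (hH : ∀ i v, γ * (v ⬝ᵥ v) ≤ v ⬝ᵥ (covOp (cR cellX c i) m2 (a * s) (qR cellX cellY q i) (WR cellX W i)
      (TR cellX cellY T i) *ᵥ v)) (ψ : Y × ι → ℝ) :
    ∑ i, ψR cellY i ψ ⬝ᵥ (keffCell cellX cellY c m2 a s q W T i *ᵥ ψR cellY i ψ)
      ≤ ψ ⬝ᵥ (keff c m2 a s q W T *ᵥ ψ) := by
  have hHΩ := covOp_form_ge_of_cells cellX cellY hc m2 (a * s) hq W T hH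
  have hu : IsUnit (covOp c m2 (a * s) q W T).det := isUnit_det_of_form_ge hγ hHΩ
  rw [← cenergy_gStar hu ψ]
  set Φ := gStar c m2 a s q W T ψ
  calc ∑ i, ψR cellY i ψ ⬝ᵥ (keffCell cellX cellY c m2 a s q W T i *ᵥ ψR cellY i ψ)
      ≤ ∑ i, cenergy (cR cellX c i) m2 a s (qR cellX cellY q i) (WR cellX W i) (TR cellX cellY T i)
          (ΦR cellX i Φ) (ψR cellY i ψ) :=
        Finset.sum_le_sum fun i _ => cenergy_ge_keff hγ hs (hH i) _ _
    _ = cenergy (ccut cellX c) m2 a s q W T Φ ψ := (cenergy_cut_eq_sum cellX cellY c m2 a s hq W T Φ ψ).symm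
    _ ≤ cenergy c m2 a s q W T Φ ψ := cenergy_cut_le cellX hc m2 a hs q W T Φ ψ

/-- *"Each term in the second sum of the right side (4.5) is non-negative, as it follows from the proof of (4.4)"* —
indeed EVERY cell term (every form `⟨ψ,Δ^{(k)}ψ⟩` of the construction (1.14) with `c ≥ 0`, `m² ≥ 0`, `a ≥ 0`,
`s ≥ 0` and `H ≥ γ > 0`) is `≥ 0`: it is the minimum of the nonnegative energy (4.2).
[cite: Balaban1983RegularityDecay, p.590 (after (4.5)), (4.1)–(4.4) p.589] -/
theorem keff_form_nonneg [Fintype X] [Fintype Y] [Fintype ι] [DecidableEq X] [DecidableEq Y] [DecidableEq ι]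
    {c : X → X → ℝ} (hc : ∀ x x', 0 ≤ c x x') {m2 a s : ℝ} (hm : 0 ≤ m2) (ha : 0 ≤ a) (hs : 0 ≤ s)
    (q : Y → X → ℝ) (W : X → X → Matrix ι ι ℝ) (T : Y → X → Matrix ι ι ℝ) {γ : ℝ} (hγ : 0 < γ)
    (hH : ∀ v, γ * (v ⬝ᵥ v) ≤ v ⬝ᵥ (covOp c m2 (a * s) q W T *ᵥ v)) (ψ : Y × ι → ℝ) :
    0 ≤ ψ ⬝ᵥ (keff c m2 a s q W T *ᵥ ψ) := by
  have hu : IsUnit (covOp c m2 (a * s) q W T).det := isUnit_det_of_form_ge hγ hH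
  rw [← cenergy_gStar hu ψ]
  unfold cenergy
  rw [kinMass_form]
  have h1 := covLap_form_nonneg hc W (gStar c m2 a s q W T ψ)
  have h2 := dotProduct_self_nonneg' (gStar c m2 a s q W T ψ)
  have h3 := dotProduct_self_nonneg' (ψ - s • (avgOp q T *ᵥ gStar c m2 a s q W T ψ))
  have h4 : 0 ≤ m2 * (gStar c m2 a s q W T ψ ⬝ᵥ gStar c m2 a s q W T ψ) := mul_nonneg hm h2
  nlinarith [mul_nonneg hs (add_nonneg h1 h4), mul_nonneg ha h3]

/-- **(4.6)** — *"Summing the inequalities (4.5) over B_i, i = 1,…,2d, we get the inequality (the left hand side of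
(1.18)) ≥ (1/2d)Σ_{⟨x,x′⟩⊂Ω^{(k)}}[…]"*: for any finite family `j ↦ (cellX_j, cellY_j)` of block-compatible cell
structures (the `2d` matchings `B_i` of p. 589 together with their singletons), the form of `Δ^{(k)}(Ω,A)` dominates
the AVERAGE over `j` of the sums of the cell forms (dropping nonnegative singleton terms, `keff_form_nonneg`, is then
at the user's disposal). [cite: Balaban1983RegularityDecay, (4.6) p.590] -/
theorem ineq46 {J : Type*} [Fintype J] [Nonempty J] [Fintype X] [Fintype Y] [Fintype ι] [Fintype C]
    [DecidableEq X] [DecidableEq Y] [DecidableEq ι] [DecidableEq C] (cellX : J → X → C) (cellY : J → Y → C)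
    {c : X → X → ℝ} (hc : ∀ x x', 0 ≤ c x x') (m2 a : ℝ) {s : ℝ} (hs : 0 ≤ s) {q : Y → X → ℝ}
    (hq : ∀ j y x, q y x ≠ 0 → cellX j x = cellY j y) (W : X → X → Matrix ι ι ℝ) (T : Y → X → Matrix ι ι ℝ)
    {γ : ℝ} (hγ : 0 < γ)
    (hH : ∀ j i v, γ * (v ⬝ᵥ v) ≤ v ⬝ᵥ (covOp (cR (cellX j) c i) m2 (a * s) (qR (cellX j) (cellY j) q i)
      (WR (cellX j) W i) (TR (cellX j) (cellY j) T i) *ᵥ v)) (ψ : Y × ι → ℝ) :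
    (Fintype.card J : ℝ)⁻¹ *
        ∑ j, ∑ i, ψR (cellY j) i ψ ⬝ᵥ (keffCell (cellX j) (cellY j) c m2 a s q W T i *ᵥ ψR (cellY j) i ψ)
      ≤ ψ ⬝ᵥ (keff c m2 a s q W T *ᵥ ψ) := by
  have h : ∀ j, ∑ i, ψR (cellY j) i ψ ⬝ᵥ (keffCell (cellX j) (cellY j) c m2 a s q W T i *ᵥ ψR (cellY j) i ψ)
      ≤ ψ ⬝ᵥ (keff c m2 a s q W T *ᵥ ψ) :=
    fun j => ineq45 (cellX j) (cellY j) hc m2 a hs (hq j) W T hγ (hH j) ψ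
  have hsum := Finset.sum_le_sum fun j (_ : j ∈ Finset.univ) => h j
  rw [Finset.sum_const, Finset.card_univ, nsmul_eq_mul] at hsum
  have hJ : (0 : ℝ) < Fintype.card J := by exact_mod_cast Fintype.card_pos
  rw [inv_mul_le_iff₀ hJ]
  exact hsum

end

end Literature.MathematicalPhysics.QuantumFieldTheory.Balaban1983to89.B4Ineq45Decoupling
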